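import Mathlib
import HarnessLib
import Summits.AtomisticToContinuum.Crystallization.Theorems.FrustratedLawDichotomyAperiodicFrustratedLawGapErgodicInvolution

/-!
# Ergodic reduction for the crux `AperiodicFrustratedLawGap` — the lazy symmetric re-rooting operator

Route `FrustratedLawDichotomy`, crux `AperiodicFrustratedLawGap` (item `stmt-AtomisticToContinuum-27623`),
registered stub `stub_ergodicReduction` (skeleton `dd3251ad731e`); second brick of step D5 (`hErg`, a.e.
ergodicity of the conditional laws), sequel of `…ErgodicInvolution`.  For a measurable EVEN weight `w ≥ 0` on
`ℝ³` whose mass on every rooted hard-core configuration is `≤ 1` (`Σ_{y ∈ S} w(y) ≤ 1`), the LAZY RE-ROOTING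
OPERATOR on nonnegative functions of the configuration,

`(P f)(S) = Σ_{y ∈ S} w(y) f(S − y) + (1 − Σ_{y ∈ S} w(y)) f(S)`   (spelled out, no definition is introduced),

is Markov (`P 1 = 1`), measurability-preserving, and SYMMETRIC against every law `ν` with Campbell measure
invariant under re-rooting: `∫ g · P f dν = ∫ f · P g dν` (mass transport, `lintegral_mul_lintegral_reroot_comm`).
This is the operator whose mean ergodic theorem (positive self-adjoint contraction on `L²(ν)`) is the planned
route to `hErg` (see the item's evidence `D5-PLAN.md`).

* `measurable_lintegral_weight`, `measurable_lintegral_weight_reroot`, `measurable_lazyReroot` — measurability;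
* `lazyReroot_one` — `P 1 = 1`;
* `lintegral_mul_lazyReroot_comm` — symmetry `∫ g · P f dν = ∫ f · P g dν`.

`[folklore]`.
-/

noncomputable section

namespace Summit.AtomisticToContinuum.Crystallization.Theorems.FrustratedLawDichotomyErgodicReduction

open MeasureTheory Set Filter ProbabilityTheory
open scoped ENNReal Classical
open Literature.Probability.Process (LocalConfig)
open Literature.Probability.Process.LocalConfig (RootedHardCoreConfig toMeasure_def measurable_toMeasure)
open Summit.AtomisticToContinuum.Crystallization.Theorems.BenjaminiSchrammLimit (isSFiniteKernel_toMeasure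
  measurable_reroot)

variable {δ : ℝ}

/-- The mass `S ↦ Σ_{y ∈ S} w(y)` of a measurable weight is a measurable function of the configuration
(`δ > 0`). [folklore] -/
theorem measurable_lintegral_weight [Fact (0 < δ)] {w : EuclideanSpace ℝ (Fin 3) → ℝ≥0∞} (hw : Measurable w) :
    Measurable fun S : RootedHardCoreConfig (EuclideanSpace ℝ (Fin 3)) δ =>
      ∫⁻ y, w y ∂((S.1 : LocalConfig (EuclideanSpace ℝ (Fin 3))).toMeasure) := by
  haveI := isSFiniteKernel_toMeasure (E := EuclideanSpace ℝ (Fin 3)) (δ := δ)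
  exact hw.lintegral_kernel (κ := (⟨fun S : RootedHardCoreConfig (EuclideanSpace ℝ (Fin 3)) δ =>
    (S.1 : LocalConfig (EuclideanSpace ℝ (Fin 3))).toMeasure, measurable_toMeasure (Fact.out : 0 < δ)⟩ :
    Kernel (RootedHardCoreConfig (EuclideanSpace ℝ (Fin 3)) δ) (EuclideanSpace ℝ (Fin 3))))

/-- The weighted re-rooting average `S ↦ Σ_{y ∈ S} w(y) f(S − y)` of a measurable `f ≥ 0` is measurable
(`δ > 0`; joint measurability of the re-rooting map, `measurable_reroot`). [folklore] -/
theorem measurable_lintegral_weight_reroot [Fact (0 < δ)] {w : EuclideanSpace ℝ (Fin 3) → ℝ≥0∞}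
    (hw : Measurable w) {f : RootedHardCoreConfig (EuclideanSpace ℝ (Fin 3)) δ → ℝ≥0∞} (hf : Measurable f) :
    Measurable fun S : RootedHardCoreConfig (EuclideanSpace ℝ (Fin 3)) δ => ∫⁻ y, w y *
      f ((fun p : RootedHardCoreConfig (EuclideanSpace ℝ (Fin 3)) δ × EuclideanSpace ℝ (Fin 3) =>
        ((if h : p.2 ∈ ((p.1.1 : LocalConfig (EuclideanSpace ℝ (Fin 3))) : Set (EuclideanSpace ℝ (Fin 3)))
          then p.1.reroot p.2 h else p.1 : RootedHardCoreConfig (EuclideanSpace ℝ (Fin 3)) δ), -p.2)) (S, y)).1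
      ∂((S.1 : LocalConfig (EuclideanSpace ℝ (Fin 3))).toMeasure) := by
  haveI := isSFiniteKernel_toMeasure (E := EuclideanSpace ℝ (Fin 3)) (δ := δ)
  have hδ : 0 < δ := Fact.out
  have hΘ : Measurable (fun p : RootedHardCoreConfig (EuclideanSpace ℝ (Fin 3)) δ × EuclideanSpace ℝ (Fin 3) =>
      ((if h : p.2 ∈ ((p.1.1 : LocalConfig (EuclideanSpace ℝ (Fin 3))) : Set (EuclideanSpace ℝ (Fin 3)))
        then p.1.reroot p.2 h else p.1 : RootedHardCoreConfig (EuclideanSpace ℝ (Fin 3)) δ), -p.2)) :=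
    measurable_reroot hδ
  have hF : Measurable (fun p : RootedHardCoreConfig (EuclideanSpace ℝ (Fin 3)) δ × EuclideanSpace ℝ (Fin 3) =>
      w p.2 * f ((fun p : RootedHardCoreConfig (EuclideanSpace ℝ (Fin 3)) δ × EuclideanSpace ℝ (Fin 3) =>
        ((if h : p.2 ∈ ((p.1.1 : LocalConfig (EuclideanSpace ℝ (Fin 3))) : Set (EuclideanSpace ℝ (Fin 3)))
          then p.1.reroot p.2 h else p.1 : RootedHardCoreConfig (EuclideanSpace ℝ (Fin 3)) δ), -p.2)) p).1) :=
    (hw.comp measurable_snd).mul (hf.comp hΘ.fst)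
  exact hF.lintegral_kernel_prod_right' (κ := (⟨fun S : RootedHardCoreConfig (EuclideanSpace ℝ (Fin 3)) δ =>
    (S.1 : LocalConfig (EuclideanSpace ℝ (Fin 3))).toMeasure, measurable_toMeasure (Fact.out : 0 < δ)⟩ :
    Kernel (RootedHardCoreConfig (EuclideanSpace ℝ (Fin 3)) δ) (EuclideanSpace ℝ (Fin 3))))

/-- **The lazy re-rooting operator preserves measurability** (`δ > 0`):
`S ↦ Σ_{y∈S} w(y) f(S−y) + (1 − Σ_{y∈S} w(y)) f(S)` is measurable for measurable `w, f ≥ 0`. [folklore] -/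
theorem measurable_lazyReroot [Fact (0 < δ)] {w : EuclideanSpace ℝ (Fin 3) → ℝ≥0∞} (hw : Measurable w)
    {f : RootedHardCoreConfig (EuclideanSpace ℝ (Fin 3)) δ → ℝ≥0∞} (hf : Measurable f) :
    Measurable fun S : RootedHardCoreConfig (EuclideanSpace ℝ (Fin 3)) δ => (∫⁻ y, w y *
      f ((fun p : RootedHardCoreConfig (EuclideanSpace ℝ (Fin 3)) δ × EuclideanSpace ℝ (Fin 3) =>
        ((if h : p.2 ∈ ((p.1.1 : LocalConfig (EuclideanSpace ℝ (Fin 3))) : Set (EuclideanSpace ℝ (Fin 3)))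
          then p.1.reroot p.2 h else p.1 : RootedHardCoreConfig (EuclideanSpace ℝ (Fin 3)) δ), -p.2)) (S, y)).1
      ∂((S.1 : LocalConfig (EuclideanSpace ℝ (Fin 3))).toMeasure)) +
      (1 - ∫⁻ y, w y ∂((S.1 : LocalConfig (EuclideanSpace ℝ (Fin 3))).toMeasure)) * f S :=
  (measurable_lintegral_weight_reroot hw hf).add
    ((measurable_const.sub (measurable_lintegral_weight hw)).mul hf)

/-- **The lazy re-rooting operator is Markov**: `P 1 = 1` on every configuration whose `w`-mass is `≤ 1`.
[folklore] -/
theorem lazyReroot_one {w : EuclideanSpace ℝ (Fin 3) → ℝ≥0∞}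
    (S : RootedHardCoreConfig (EuclideanSpace ℝ (Fin 3)) δ)
    (hS : ∫⁻ y, w y ∂((S.1 : LocalConfig (EuclideanSpace ℝ (Fin 3))).toMeasure) ≤ 1) :
    (∫⁻ y, w y * (fun _ : RootedHardCoreConfig (EuclideanSpace ℝ (Fin 3)) δ => (1 : ℝ≥0∞))
      ((fun p : RootedHardCoreConfig (EuclideanSpace ℝ (Fin 3)) δ × EuclideanSpace ℝ (Fin 3) =>
        ((if h : p.2 ∈ ((p.1.1 : LocalConfig (EuclideanSpace ℝ (Fin 3))) : Set (EuclideanSpace ℝ (Fin 3)))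
          then p.1.reroot p.2 h else p.1 : RootedHardCoreConfig (EuclideanSpace ℝ (Fin 3)) δ), -p.2)) (S, y)).1
      ∂((S.1 : LocalConfig (EuclideanSpace ℝ (Fin 3))).toMeasure)) +
      (1 - ∫⁻ y, w y ∂((S.1 : LocalConfig (EuclideanSpace ℝ (Fin 3))).toMeasure)) *
        (fun _ : RootedHardCoreConfig (EuclideanSpace ℝ (Fin 3)) δ => (1 : ℝ≥0∞)) S = 1 := by
  simp only [mul_one]
  exact add_tsub_cancel_of_le hS

/-- **Symmetry of the lazy re-rooting operator (mass transport).**  For a law `ν` on rooted `δ`-hard-core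
configurations (`δ > 0`) with Campbell measure invariant under the re-rooting involution, a measurable even
weight `w ≥ 0` and measurable `f, g ≥ 0`: `∫ g · P f dν = ∫ f · P g dν` for the lazy re-rooting operator
`(P f)(S) = Σ_{y∈S} w(y) f(S−y) + (1 − Σ_{y∈S} w(y)) f(S)` — the re-rooting part by
`lintegral_mul_lintegral_reroot_comm`, the lazy part pointwise. [folklore] -/
theorem lintegral_mul_lazyReroot_comm [Fact (0 < δ)]
    {ν : Measure (RootedHardCoreConfig (EuclideanSpace ℝ (Fin 3)) δ)} [SFinite ν]
    (hinv : haveI := isSFiniteKernel_toMeasure (E := EuclideanSpace ℝ (Fin 3)) (δ := δ)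
      (ν ⊗ₘ (⟨fun S : RootedHardCoreConfig (EuclideanSpace ℝ (Fin 3)) δ =>
        (S.1 : LocalConfig (EuclideanSpace ℝ (Fin 3))).toMeasure,
        measurable_toMeasure (Fact.out : 0 < δ)⟩ :
        Kernel (RootedHardCoreConfig (EuclideanSpace ℝ (Fin 3)) δ) (EuclideanSpace ℝ (Fin 3)))).map
      (fun p : RootedHardCoreConfig (EuclideanSpace ℝ (Fin 3)) δ × EuclideanSpace ℝ (Fin 3) =>
        ((if h : p.2 ∈ ((p.1.1 : LocalConfig (EuclideanSpace ℝ (Fin 3))) : Set (EuclideanSpace ℝ (Fin 3)))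
          then p.1.reroot p.2 h else p.1 : RootedHardCoreConfig (EuclideanSpace ℝ (Fin 3)) δ), -p.2)) =
      ν ⊗ₘ (⟨fun S : RootedHardCoreConfig (EuclideanSpace ℝ (Fin 3)) δ =>
        (S.1 : LocalConfig (EuclideanSpace ℝ (Fin 3))).toMeasure,
        measurable_toMeasure (Fact.out : 0 < δ)⟩ :
        Kernel (RootedHardCoreConfig (EuclideanSpace ℝ (Fin 3)) δ) (EuclideanSpace ℝ (Fin 3))))
    {w : EuclideanSpace ℝ (Fin 3) → ℝ≥0∞} (hw : Measurable w) (hws : ∀ y, w (-y) = w y)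
    {f g : RootedHardCoreConfig (EuclideanSpace ℝ (Fin 3)) δ → ℝ≥0∞} (hf : Measurable f) (hg : Measurable g) :
    ∫⁻ S, g S * ((∫⁻ y, w y *
      f ((fun p : RootedHardCoreConfig (EuclideanSpace ℝ (Fin 3)) δ × EuclideanSpace ℝ (Fin 3) =>
        ((if h : p.2 ∈ ((p.1.1 : LocalConfig (EuclideanSpace ℝ (Fin 3))) : Set (EuclideanSpace ℝ (Fin 3)))
          then p.1.reroot p.2 h else p.1 : RootedHardCoreConfig (EuclideanSpace ℝ (Fin 3)) δ), -p.2)) (S, y)).1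
      ∂((S.1 : LocalConfig (EuclideanSpace ℝ (Fin 3))).toMeasure)) +
      (1 - ∫⁻ y, w y ∂((S.1 : LocalConfig (EuclideanSpace ℝ (Fin 3))).toMeasure)) * f S) ∂ν =
    ∫⁻ S, f S * ((∫⁻ y, w y *
      g ((fun p : RootedHardCoreConfig (EuclideanSpace ℝ (Fin 3)) δ × EuclideanSpace ℝ (Fin 3) =>
        ((if h : p.2 ∈ ((p.1.1 : LocalConfig (EuclideanSpace ℝ (Fin 3))) : Set (EuclideanSpace ℝ (Fin 3)))
          then p.1.reroot p.2 h else p.1 : RootedHardCoreConfig (EuclideanSpace ℝ (Fin 3)) δ), -p.2)) (S, y)).1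
      ∂((S.1 : LocalConfig (EuclideanSpace ℝ (Fin 3))).toMeasure)) +
      (1 - ∫⁻ y, w y ∂((S.1 : LocalConfig (EuclideanSpace ℝ (Fin 3))).toMeasure)) * g S) ∂ν := by
  have hAf := measurable_lintegral_weight_reroot (δ := δ) hw hf
  have hAg := measurable_lintegral_weight_reroot (δ := δ) hw hg
  have hm := measurable_lintegral_weight (δ := δ) hw
  have hsymm := lintegral_mul_lintegral_reroot_comm (δ := δ) hinv hw hws hf hg
  dsimp only at hAf hAg hsymm ⊢
  simp_rw [mul_add]
  rw [lintegral_add_left (hg.fun_mul hAf), lintegral_add_left (hf.fun_mul hAg), hsymm]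
  congr 1
  refine lintegral_congr fun S => ?_
  ring

end Summit.AtomisticToContinuum.Crystallization.Theorems.FrustratedLawDichotomyErgodicReduction

end
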